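import Summits.AnomalousDissipation.AnomalousDissipation.Theorems.ScalarAnomalySteadySourceFormal.Negative.WienRepr

/-!
# Negative knowledge for the crux `ScalarAnomalySteadySourceFormal` (stmt-AnomalousDissipation-0448), X-c:
# Wiener-class stirring — the band inequality (interior transport cancels)

Certified copy of §12.3 of the cdisprove work file.  For a finite mode set `𝔅`, bounded modes `Y` and a
conjugate-symmetric, transversal, absolutely summable coefficient function `C`, the transport pairing
`∑_{p∈𝔅} N_p(Y) conj Y_p` splits into a FINITE interior part (`q = p - r`, `r ∈ 𝔅`) — real by the
involution `(p,r) ↦ (r,p)` (`conj_wInterior`) — and the boundary series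
`wBdryFlux 𝔅 C Y = ∑_{p∈𝔅} ∑' q 𝟙[p-q ∉ 𝔅] (p·C_q) Y(p-q) conj Y_p`; hence
`Re ∑_{p∈𝔅} N_p conj Y_p = Re (2πi · wBdryFlux)` (`re_sum_wTransportMode_mul_conj`) and the
**band dissipation inequality** along the representatives (`wband_dissipation_le`):
`2ν ∫_{(0,T)} bandDiss 𝔅 ỹ ≤ ∑_{p∈𝔅}‖𝓕θ₀(p)‖² + 4π ∫_{(0,T)} ‖wBdryFlux‖ + 2 ∫_{(0,T)} ‖sourcePairing‖`.

Supports stmt-AnomalousDissipation-0448 (the Wiener-class no-go, files `Wien*`).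
-/

set_option linter.dupNamespace false

noncomputable section

open scoped BigOperators Topology ENNReal NNReal InnerProductSpace ContDiff
open Filter Set Function MeasureTheory UnitAddTorus Complex

namespace Summit.AnomalousDissipation.AnomalousDissipation.Theorems.ScalarAnomalySteadySourceFormal.Negative

open Literature.Analysis
open Literature.Analysis.FunctionSpaces Literature.Analysis.FunctionSpaces.Torus
open Literature.Analysis.FluidPDE Literature.Analysis.FluidPDE.Torus

/-- The frequency lattice `ℤ²` (local notation). -/
local notation "ℤ²" => Fin 2 → ℤ

section WAlgebra

variable {C : ℤ² → EuclideanSpace ℂ (Fin 2)} {Y : ℤ² → ℂ} {B : ℝ}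

/-- The transport term `T(p,q) = (p·C_q) Y(p-q) conj Y_p`. [folklore] -/
def wTerm (C : ℤ² → EuclideanSpace ℂ (Fin 2)) (Y : ℤ² → ℂ) (p q : ℤ²) : ℂ :=
  zdot p (C q) * Y (p - q) * (starRingEnd ℂ) (Y p)

/-- Summability of `q ↦ T(p,q)` for bounded `Y`. [folklore] -/
theorem summable_wTerm (hs : Summable fun q => ‖C q‖) (hY : ∀ q, ‖Y q‖ ≤ B) (p : ℤ²) :
    Summable fun q => wTerm C Y p q := by
  unfold wTerm
  exact (summable_zdot_mul hs hY p).mul_right _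

/-- **The boundary flux** of `𝔅` under Wiener-class stirring. [folklore] -/
def wBdryFlux (𝔅 : Finset ℤ²) (C : ℤ² → EuclideanSpace ℂ (Fin 2)) (Y : ℤ² → ℂ) : ℂ :=
  ∑ p ∈ 𝔅, ∑' q, if p - q ∈ 𝔅 then 0 else wTerm C Y p q

/-- The interior part (finite: `q = p - r`, `r ∈ 𝔅`). [folklore] -/
def wInterior (𝔅 : Finset ℤ²) (C : ℤ² → EuclideanSpace ℂ (Fin 2)) (Y : ℤ² → ℂ) : ℂ :=
  ∑ p ∈ 𝔅, ∑ r ∈ 𝔅, wTerm C Y p (p - r)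

/-- Summability of the boundary integrand. [folklore] -/
theorem summable_wTerm_ite (hs : Summable fun q => ‖C q‖) (hY : ∀ q, ‖Y q‖ ≤ B) (𝔅 : Finset ℤ²) (p : ℤ²) :
    Summable fun q => if p - q ∈ 𝔅 then (0 : ℂ) else wTerm C Y p q := by
  refine Summable.of_norm_bounded (g := fun q => ‖wTerm C Y p q‖) (summable_wTerm hs hY p).norm fun q => ?_
  split_ifs <;> simp

/-- **Interior/boundary split**: `∑' q T(p,q) = ∑_{r∈𝔅} T(p,p-r) + ∑' q 𝟙[p-q∉𝔅] T(p,q)`. [folklore] -/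
theorem tsum_wTerm_split (hs : Summable fun q => ‖C q‖) (hY : ∀ q, ‖Y q‖ ≤ B) (𝔅 : Finset ℤ²) (p : ℤ²) :
    ∑' q, wTerm C Y p q = ∑ r ∈ 𝔅, wTerm C Y p (p - r) + ∑' q, if p - q ∈ 𝔅 then 0 else wTerm C Y p q := by
  classical
  have hsplit : ∀ q, wTerm C Y p q = (if p - q ∈ 𝔅 then wTerm C Y p q else 0) + (if p - q ∈ 𝔅 then 0 else wTerm C Y p q) := by
    intro q; split_ifs <;> simp
  have hfin : ∑' q, (if p - q ∈ 𝔅 then wTerm C Y p q else 0) = ∑ r ∈ 𝔅, wTerm C Y p (p - r) := by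
    have hsupp : ∀ q ∉ 𝔅.image (fun r => p - r), (if p - q ∈ 𝔅 then wTerm C Y p q else 0) = 0 := by
      intro q hq
      rw [if_neg]
      intro hmem
      exact hq (Finset.mem_image.2 ⟨p - q, hmem, by abel⟩)
    rw [tsum_eq_sum hsupp, Finset.sum_image fun r _ r' _ h => by simpa using h]
    refine Finset.sum_congr rfl fun r hr => ?_
    rw [if_pos (by simpa using hr)]
  calc ∑' q, wTerm C Y p q
      = ∑' q, ((if p - q ∈ 𝔅 then wTerm C Y p q else 0) + (if p - q ∈ 𝔅 then 0 else wTerm C Y p q)) := tsum_congr hsplit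
    _ = ∑' q, (if p - q ∈ 𝔅 then wTerm C Y p q else 0) + ∑' q, (if p - q ∈ 𝔅 then 0 else wTerm C Y p q) := by
        refine Summable.tsum_add ?_ (summable_wTerm_ite hs hY 𝔅 p)
        refine Summable.of_norm_bounded (g := fun q => ‖wTerm C Y p q‖) (summable_wTerm hs hY p).norm fun q => ?_
        split_ifs <;> simp
    _ = _ := by rw [hfin]

/-- **The interior is real**: with conjugate symmetry and transversality, `conj (interior) = interior`
(the involution `(p,r) ↦ (r,p)`). [folklore] -/
theorem conj_wInterior (hsymm : ∀ q, C (-q) = EuclideanSpace.conjVec (C q)) (htrans : ∀ q, zdot q (C q) = 0)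
    (𝔅 : Finset ℤ²) (Y : ℤ² → ℂ) : (starRingEnd ℂ) (wInterior 𝔅 C Y) = wInterior 𝔅 C Y := by
  unfold wInterior
  rw [map_sum]
  conv_lhs => rw [Finset.sum_congr rfl (fun p _ => map_sum (starRingEnd ℂ) _ 𝔅)]
  rw [Finset.sum_comm]
  refine Finset.sum_congr rfl fun p _ => Finset.sum_congr rfl fun r _ => ?_
  -- `conj T(r, r - p) = T(p, p - r)`
  unfold wTerm
  have hz : zdot r (C (r - p)) = (starRingEnd ℂ) (zdot p (C (p - r))) := by
    rw [conj_zdot, show r - p = -(p - r) by abel, hsymm]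
    -- `zdot r w = zdot p w` for `w = conjVec (C (p-r))`, by transversality
    have h0 : zdot (p - r) (EuclideanSpace.conjVec (C (p - r))) = 0 := by
      rw [← conj_zdot, htrans, map_zero]
    have := zdot_sub p r (EuclideanSpace.conjVec (C (p - r)))
    rw [h0] at this
    exact (sub_eq_zero.1 this.symm).symm
  rw [map_mul, map_mul, Complex.conj_conj, hz, Complex.conj_conj, sub_sub_cancel, sub_sub_cancel]
  ring

/-- **Real part of the transport pairing = real part of `2πi ·` boundary flux.** [folklore] -/
theorem re_sum_wTransportMode_mul_conj (hs : Summable fun q => ‖C q‖) (hY : ∀ q, ‖Y q‖ ≤ B)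
    (hsymm : ∀ q, C (-q) = EuclideanSpace.conjVec (C q)) (htrans : ∀ q, zdot q (C q) = 0) (𝔅 : Finset ℤ²) :
    (∑ p ∈ 𝔅, wTransportMode C Y p * (starRingEnd ℂ) (Y p)).re = (2 * Real.pi * I * wBdryFlux 𝔅 C Y).re := by
  have hsplit : ∑ p ∈ 𝔅, wTransportMode C Y p * (starRingEnd ℂ) (Y p) =
      2 * Real.pi * I * (wInterior 𝔅 C Y + wBdryFlux 𝔅 C Y) := by
    have e1 : ∀ p ∈ 𝔅, wTransportMode C Y p * (starRingEnd ℂ) (Y p) = 2 * Real.pi * I * ∑' q, wTerm C Y p q := by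
      intro p _
      rw [wTransportMode, mul_assoc, ← tsum_mul_right]
      rfl
    rw [Finset.sum_congr rfl e1, ← Finset.mul_sum]
    congr 1
    rw [wInterior, wBdryFlux, ← Finset.sum_add_distrib]
    exact Finset.sum_congr rfl fun p _ => tsum_wTerm_split hs hY 𝔅 p
  rw [hsplit, mul_add, Complex.add_re]
  have hreal : (2 * Real.pi * I * wInterior 𝔅 C Y).re = 0 := by
    have him : (wInterior 𝔅 C Y).im = 0 := Complex.conj_eq_iff_im.1 (conj_wInterior hsymm htrans 𝔅 Y)
    simp [Complex.mul_re, Complex.mul_im, him]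
  rw [hreal, zero_add]

/-- **The band integrand, expanded** (Wiener-class stirring):
`∑_{p∈𝔅} 2⟪Y_p, wModeRHS_p⟫ = -2ν bandDiss - 2 Re(2πi wBdryFlux) + 2 Re(sourcePairing)`. [folklore] -/
theorem sum_two_inner_wModeRHS {ν : ℝ} {Cf : ℝ → ℤ² → EuclideanSpace ℂ (Fin 2)} (h : UnitAddTorus (Fin 2) → ℝ)
    (Yf : ℝ → ℤ² → ℂ) (s : ℝ) (hs : Summable fun q => ‖Cf s q‖) {B : ℝ} (hY : ∀ q, ‖Yf s q‖ ≤ B)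
    (hsymm : ∀ q, Cf s (-q) = EuclideanSpace.conjVec (Cf s q)) (htrans : ∀ q, zdot q (Cf s q) = 0) (𝔅 : Finset ℤ²) :
    ∑ p ∈ 𝔅, 2 * ⟪Yf s p, wModeRHS ν Cf h Yf p s⟫_ℝ =
      -2 * ν * bandDiss 𝔅 (Yf s) - 2 * (2 * Real.pi * I * wBdryFlux 𝔅 (Cf s) (Yf s)).re +
        2 * (sourcePairing 𝔅 h (Yf s)).re := by
  have e : ∀ p ∈ 𝔅, 2 * ⟪Yf s p, wModeRHS ν Cf h Yf p s⟫_ℝ =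
      -2 * (4 * Real.pi ^ 2 * ν * freqNormSq p) * ‖Yf s p‖ ^ 2 -
        2 * (wTransportMode (Cf s) (Yf s) p * (starRingEnd ℂ) (Yf s p)).re +
        2 * (mFourierCoeff (fun x => (h x : ℂ)) p * (starRingEnd ℂ) (Yf s p)).re := fun p _ =>
    two_inner_modeRHS _ _ _ _
  rw [Finset.sum_congr rfl e]
  have hN : ∑ p ∈ 𝔅, 2 * (wTransportMode (Cf s) (Yf s) p * (starRingEnd ℂ) (Yf s p)).re =
      2 * (2 * Real.pi * I * wBdryFlux 𝔅 (Cf s) (Yf s)).re := by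
    rw [← Finset.mul_sum, ← Complex.re_sum, re_sum_wTransportMode_mul_conj hs hY hsymm htrans 𝔅]
  have hH : ∑ p ∈ 𝔅, 2 * (mFourierCoeff (fun x => (h x : ℂ)) p * (starRingEnd ℂ) (Yf s p)).re =
      2 * (sourcePairing 𝔅 h (Yf s)).re := by
    rw [← Finset.mul_sum, ← Complex.re_sum]
    rfl
  have hDd : ∑ p ∈ 𝔅, -2 * (4 * Real.pi ^ 2 * ν * freqNormSq p) * ‖Yf s p‖ ^ 2 = -2 * ν * bandDiss 𝔅 (Yf s) := by
    rw [bandDiss, Finset.mul_sum]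
    exact Finset.sum_congr rfl fun p _ => by ring
  rw [Finset.sum_add_distrib, Finset.sum_sub_distrib, hN, hH, hDd]

/-- Norm bound of the boundary flux: `‖wBdryFlux‖ ≤ ∑_{p∈𝔅} ∑' q ‖T(p,q)‖`. [folklore] -/
theorem norm_wBdryFlux_le_tsum_norm (hs : Summable fun q => ‖C q‖) (hY : ∀ q, ‖Y q‖ ≤ B) (𝔅 : Finset ℤ²) :
    ‖wBdryFlux 𝔅 C Y‖ ≤ ∑ p ∈ 𝔅, ∑' q, ‖if p - q ∈ 𝔅 then (0 : ℂ) else wTerm C Y p q‖ := by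
  unfold wBdryFlux
  refine (norm_sum_le _ _).trans (Finset.sum_le_sum fun p _ => ?_)
  exact norm_tsum_le_tsum_norm (summable_wTerm_ite hs hY 𝔅 p).norm

end WAlgebra

section WBand

variable {ν : ℝ} {C : ℝ → ℤ² → EuclideanSpace ℂ (Fin 2)} {a : ℤ² → ℝ}
  {u : ℝ → UnitAddTorus (Fin 2) → EuclideanSpace ℝ (Fin 2)} {h θ₀ : UnitAddTorus (Fin 2) → ℝ}
  {θ : ℝ → UnitAddTorus (Fin 2) → ℝ}

/-- Continuity of the boundary flux along the representatives on `(0,T)`. [folklore] -/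
theorem continuousOn_wBdryFlux (hw : IsWeakScalarTransportForced ν u (fun _ => h) θ₀ θ)
    (hu : ∀ s, u s = wienField (C s)) (hCa : ∀ s q, ‖C s q‖ ≤ a q) (hsa : Summable a)
    (hsymm : ∀ s q, C s (-q) = EuclideanSpace.conjVec (C s q)) (hcont : ∀ q, Continuous fun s => C s q)
    (hh : Integrable h volume) (hθ₀ : Integrable θ₀ volume) {T : ℝ} (hT : 0 < T) (𝔅 : Finset ℤ²) :
    ContinuousOn (fun t => wBdryFlux 𝔅 (C t) (wcmodes ν C h θ₀ θ t)) (Ioo 0 T) := by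
  classical
  obtain ⟨B, hB0, hB⟩ := norm_wcmodes_le hw hu hCa hsa hsymm hcont hh hθ₀ hT
  have hY : ∀ q, ContinuousOn (fun s => wcmodes ν C h θ₀ θ s q) (Ioo 0 T) :=
    fun q => (continuousOn_wcmodes hw hCa hsa hcont hT q).mono Ioo_subset_Icc_self
  unfold wBdryFlux
  refine continuousOn_finsetSum _ fun p _ => ?_
  refine continuousOn_tsum (fun q => ?_) (hsa.mul_left ((∑ j, |(p j : ℝ)|) * B * B)) fun q s hs => ?_
  · split_ifs
    · exact continuousOn_const
    · unfold wTerm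
      exact (((continuous_zdot_coeff hcont p q).continuousOn.mul (hY (p - q))).mul (hY p).star)
  · have ha : 0 ≤ a q := (norm_nonneg _).trans (hCa s q)
    split_ifs
    · simp only [norm_zero]; positivity
    · unfold wTerm
      rw [norm_mul, Complex.norm_conj]
      calc ‖zdot p (C s q) * wcmodes ν C h θ₀ θ s (p - q)‖ * ‖wcmodes ν C h θ₀ θ s p‖
          ≤ ((∑ j, |(p j : ℝ)|) * B * a q) * B :=
            mul_le_mul (norm_transportTerm_le hCa (hB s hs) p q s) (hB s hs p) (norm_nonneg _) (by positivity)
        _ = (∑ j, |(p j : ℝ)|) * B * B * a q := by ring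

/-- Boundedness of the boundary flux along the representatives on `(0,T)`. [folklore] -/
theorem norm_wBdryFlux_wcmodes_le (hw : IsWeakScalarTransportForced ν u (fun _ => h) θ₀ θ)
    (hu : ∀ s, u s = wienField (C s)) (hCa : ∀ s q, ‖C s q‖ ≤ a q) (hsa : Summable a)
    (hsymm : ∀ s q, C s (-q) = EuclideanSpace.conjVec (C s q)) (hcont : ∀ q, Continuous fun s => C s q)
    (hh : Integrable h volume) (hθ₀ : Integrable θ₀ volume) {T : ℝ} (hT : 0 < T) (𝔅 : Finset ℤ²) :
    ∃ K : ℝ, ∀ t ∈ Ioo 0 T, ‖wBdryFlux 𝔅 (C t) (wcmodes ν C h θ₀ θ t)‖ ≤ K := by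
  obtain ⟨B, hB0, hB⟩ := norm_wcmodes_le hw hu hCa hsa hsymm hcont hh hθ₀ hT
  refine ⟨∑ p ∈ 𝔅, (∑ j, |(p j : ℝ)|) * B * B * ∑' q, a q, fun t ht => ?_⟩
  refine (norm_wBdryFlux_le_tsum_norm (summable_norm_of_majorant hCa hsa t) (hB t ht) 𝔅).trans
    (Finset.sum_le_sum fun p _ => ?_)
  rw [← tsum_mul_left]
  refine Summable.tsum_le_tsum (fun q => ?_) (summable_wTerm_ite (summable_norm_of_majorant hCa hsa t) (hB t ht) 𝔅 p).norm
    (hsa.mul_left _)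
  have ha : 0 ≤ a q := (norm_nonneg _).trans (hCa t q)
  split_ifs
  · simp only [norm_zero]; positivity
  · unfold wTerm
    rw [norm_mul, Complex.norm_conj]
    calc ‖zdot p (C t q) * wcmodes ν C h θ₀ θ t (p - q)‖ * ‖wcmodes ν C h θ₀ θ t p‖
        ≤ ((∑ j, |(p j : ℝ)|) * B * a q) * B :=
          mul_le_mul (norm_transportTerm_le hCa (hB t ht) p q t) (hB t ht p) (norm_nonneg _) (by positivity)
      _ = (∑ j, |(p j : ℝ)|) * B * B * a q := by ring

/-- **The band dissipation inequality** (Wiener-class stirring), along the representatives, with set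
integrals over `(0,T)`:
`2ν ∫ bandDiss 𝔅 ỹ ≤ ∑_{p∈𝔅} ‖𝓕θ₀(p)‖² + 4π ∫ ‖wBdryFlux‖ + 2 ∫ ‖sourcePairing‖`. [folklore] -/
theorem wband_dissipation_le (hw : IsWeakScalarTransportForced ν u (fun _ => h) θ₀ θ)
    (hu : ∀ s, u s = wienField (C s)) (hCa : ∀ s q, ‖C s q‖ ≤ a q) (hsa : Summable a)
    (hsymm : ∀ s q, C s (-q) = EuclideanSpace.conjVec (C s q)) (hcont : ∀ q, Continuous fun s => C s q)
    (htrans : ∀ s q, zdot q (C s q) = 0)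
    (hh : Integrable h volume) (hθ₀ : Integrable θ₀ volume) {T : ℝ} (hT : 0 < T) (𝔅 : Finset ℤ²) :
    2 * ν * ∫ t in Ioo 0 T, bandDiss 𝔅 (wcmodes ν C h θ₀ θ t) ≤
      bandEnergy 𝔅 (fun p => mFourierCoeff (fun x => (θ₀ x : ℂ)) p) +
        4 * Real.pi * (∫ t in Ioo 0 T, ‖wBdryFlux 𝔅 (C t) (wcmodes ν C h θ₀ θ t)‖) +
        2 * ∫ t in Ioo 0 T, ‖sourcePairing 𝔅 h (wcmodes ν C h θ₀ θ t)‖ := by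
  obtain ⟨B, hB0, hB⟩ := norm_wcmodes_le hw hu hCa hsa hsymm hcont hh hθ₀ hT
  set Y := wcmodes ν C h θ₀ θ with hYdef
  have hid := wbandEnergy_sub_eq_integral hw hu hCa hsa hsymm hcont hh hθ₀ hT 𝔅
  rw [intervalIntegral.integral_of_le hT.le, integral_Ioc_eq_integral_Ioo] at hid
  have hpt : ∀ t ∈ Ioo 0 T, ∑ p ∈ 𝔅, 2 * ⟪Y t p, wcmodeRHS ν C h θ₀ θ p t⟫_ℝ =
      -2 * ν * bandDiss 𝔅 (Y t) - 2 * (2 * Real.pi * I * wBdryFlux 𝔅 (C t) (Y t)).re + 2 * (sourcePairing 𝔅 h (Y t)).re :=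
    fun t ht => sum_two_inner_wModeRHS h Y t (summable_norm_of_majorant hCa hsa t) (hB t ht) (hsymm t) (htrans t) 𝔅
  rw [setIntegral_congr_fun measurableSet_Ioo hpt] at hid
  -- integrability of the three pieces on `(0,T)`
  have hYc : ∀ q, ContinuousOn (fun s => Y s q) (Icc 0 T) := fun q => continuousOn_wcmodes hw hCa hsa hcont hT q
  have hDc : ContinuousOn (fun t => bandDiss 𝔅 (Y t)) (Icc 0 T) := by
    unfold bandDiss
    exact continuousOn_finsetSum _ fun p _ => continuousOn_const.mul (((hYc p).norm).pow 2)
  have hPc : ContinuousOn (fun t => sourcePairing 𝔅 h (Y t)) (Icc 0 T) := by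
    unfold sourcePairing
    exact continuousOn_finsetSum _ fun p _ => continuousOn_const.mul (hYc p).star
  have iD : IntegrableOn (fun t => bandDiss 𝔅 (Y t)) (Ioo 0 T) volume :=
    (hDc.integrableOn_compact isCompact_Icc).mono_set Ioo_subset_Icc_self
  have iP : IntegrableOn (fun t => (sourcePairing 𝔅 h (Y t)).re) (Ioo 0 T) volume :=
    ((Complex.continuous_re.comp_continuousOn hPc).integrableOn_compact isCompact_Icc).mono_set Ioo_subset_Icc_self
  have iPn : IntegrableOn (fun t => ‖sourcePairing 𝔅 h (Y t)‖) (Ioo 0 T) volume :=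
    ((hPc.norm).integrableOn_compact isCompact_Icc).mono_set Ioo_subset_Icc_self
  obtain ⟨K, hK⟩ := norm_wBdryFlux_wcmodes_le hw hu hCa hsa hsymm hcont hh hθ₀ hT 𝔅
  have hFm : AEStronglyMeasurable (fun t => wBdryFlux 𝔅 (C t) (Y t)) (volume.restrict (Ioo 0 T)) :=
    (continuousOn_wBdryFlux hw hu hCa hsa hsymm hcont hh hθ₀ hT 𝔅).aestronglyMeasurable measurableSet_Ioo
  have iFn : IntegrableOn (fun t => ‖wBdryFlux 𝔅 (C t) (Y t)‖) (Ioo 0 T) volume := by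
    refine IntegrableOn.of_bound measure_Ioo_lt_top hFm.norm K ?_
    exact (ae_restrict_iff' measurableSet_Ioo).2 (Eventually.of_forall fun t ht => by rw [norm_norm]; exact hK t ht)
  have hn2πI : ‖(2 * (Real.pi : ℂ) * I)‖ = 2 * Real.pi := by
    simp [Complex.norm_real, abs_of_pos Real.pi_pos]
  have hre_le : ∀ t, |(2 * Real.pi * I * wBdryFlux 𝔅 (C t) (Y t)).re| ≤ 2 * Real.pi * ‖wBdryFlux 𝔅 (C t) (Y t)‖ := by
    intro t
    refine (Complex.abs_re_le_norm _).trans (le_of_eq ?_)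
    rw [norm_mul, hn2πI]
  have iF : IntegrableOn (fun t => (2 * Real.pi * I * wBdryFlux 𝔅 (C t) (Y t)).re) (Ioo 0 T) volume := by
    refine IntegrableOn.of_bound measure_Ioo_lt_top (Complex.continuous_re.comp_aestronglyMeasurable (hFm.const_mul _)) (2 * Real.pi * K) ?_
    refine (ae_restrict_iff' measurableSet_Ioo).2 (Eventually.of_forall fun t ht => ?_)
    rw [Real.norm_eq_abs]
    exact (hre_le t).trans (mul_le_mul_of_nonneg_left (hK t ht) (by positivity))
  have i1 : Integrable (fun t => -2 * ν * bandDiss 𝔅 (Y t) - 2 * (2 * Real.pi * I * wBdryFlux 𝔅 (C t) (Y t)).re)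
      (volume.restrict (Ioo 0 T)) := (iD.const_mul _).sub (iF.const_mul _)
  rw [integral_add i1 (iP.const_mul _), integral_sub (iD.const_mul _) (iF.const_mul _),
    integral_const_mul, integral_const_mul, integral_const_mul] at hid
  have hE0 : bandEnergy 𝔅 (Y 0) = bandEnergy 𝔅 (fun p => mFourierCoeff (fun x => (θ₀ x : ℂ)) p) := by
    simp only [bandEnergy, hYdef, wcmodes_zero]
  have hET : 0 ≤ bandEnergy 𝔅 (Y T) := bandEnergy_nonneg _ _
  have hF' : |∫ t in Ioo 0 T, (2 * Real.pi * I * wBdryFlux 𝔅 (C t) (Y t)).re| ≤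
      2 * Real.pi * ∫ t in Ioo 0 T, ‖wBdryFlux 𝔅 (C t) (Y t)‖ := by
    rw [← integral_const_mul]
    exact (abs_integral_le_integral_abs).trans (integral_mono_ae iF.abs (iFn.const_mul _) (Eventually.of_forall fun t => hre_le t))
  have hP' : |∫ t in Ioo 0 T, (sourcePairing 𝔅 h (Y t)).re| ≤ ∫ t in Ioo 0 T, ‖sourcePairing 𝔅 h (Y t)‖ :=
    (abs_integral_le_integral_abs).trans (integral_mono_ae iP.abs iPn (Eventually.of_forall fun t => Complex.abs_re_le_norm _))
  have h1 := (abs_le.1 hF').1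
  have h2 := (abs_le.1 hP').2
  rw [hE0] at hid
  linarith [hid, hET, h1, h2]

end WBand

end Summit.AnomalousDissipation.AnomalousDissipation.Theorems.ScalarAnomalySteadySourceFormal.Negative
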